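import Summits.Ventures.HSemireg.ContractionSpanFourierDual
import Summits.Ventures.HSemireg.ContractionSpanKunnethBox
import Mathlib.LinearAlgebra.Dual.Basis
import HarnessLib

/-!
# Venture HSemireg — the Fourier duality of a BASIS volume pair: `E ∘ D = id`, `D ∘ E = id`, and the
# unconditional class-level FM-invariance of the polyvector contraction rank

HONEST FRAMING. Pure linear algebra continuing `ContractionSpanFourierDual.lean` (seat p6 of the computation cell
`pub-hsemireg`): there the rank theorem `rank_span_pairDual_eq` carries the hypothesis «the two volume forms pair to a
UNIT `c`»; here `c = 1` is COMPUTED for the volume pair of a basis and its dual basis (in opposite orders), so the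
FM-invariance of th-7's contraction rank becomes unconditional for a finite-dimensional `V` over a field. Nothing here is
a claim about any variety; no Fourier–Mukai functor is constructed; nothing here says that HC / HC_CM / HC_AV holds.
Everything is PROVED; no named fact, no new definition.

Contents: §1 telescoping lemmas (`ι_d (z ∧ w) = (ι_d z) ∧ w` for `d(w) = 0`; `pairAct` of a list of vectors past a
right factor; **`pairAct_prod_prod_reverse`**: for pairs `(mᵢ, nᵢ)` with `φ mᵢ nᵢ = 1` and `φ m_j nᵢ = 0` (`i` before `j`),
`(m₁ ∧ ⋯ ∧ m_k) ⌟ (n_k ∧ ⋯ ∧ n₁) = 1`). §2 For a basis `b` of `V` indexed by `Fin n` (dual basis `b^*`):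
`ω_b = b₀ ∧ ⋯ ∧ b_{n-1}`, `ω'_b = b^*_{n-1} ∧ ⋯ ∧ b^*_0` are top forms, `E ω_b = 1`, `D ω'_b = 1`
(`D = pairDual id ω_b`, `E = pairDual eval ω'_b`), hence `E ∘ D = id`, `D ∘ E = id` (`pairDual_eval_comp_id`), and
**`rank_span_fourier_eq`**: `rank span_V L Θ x = rank span_{V^*} Θ (eval L) (E x)` for EVERY `x ∈ Λ V`, `Θ` killing `L` —
«`r(X, x) = r(X̂, F x)`» at class level, with `(H^{0,1}, H⁰(T))` exchanged. The identification of the census classes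
(`ch(Φ E) = F(ch E)`, Mukai / Beauville / Huybrechts) stays BY NAME / BY VALUE; so does the dictionary `H¹(X̂) = H¹(X)^*`.
SIGN CONVENTIONS: the printed cohomological transform differs from `E` on `Λᵖ` at most by a sign depending on `p` only
(conventions of the Poincaré duality, [Lange2023AbelianVarietiesComplex] §6.2.4; on EVEN classes a sign pattern `(-1)^{p/2}`
is the automorphism `Λ(i·id)`, which preserves `L`, `Θ` and hence the rank by `rank_span_map_equiv` below) — the
comparison with the printed `F` itself is NOT formalised here.
References: [BourbakiAlgebre1a3] Ch. III §7 no. 1, §11 no. 9, §11 no. 11 Prop. 12; [Mukai1981] Thm. 2.2;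
[Lange2023AbelianVarietiesComplex] §6.2.4; [BuchweitzFlenner2008HH] Prop. 6.4.4.
-/

noncomputable section

open CliffordAlgebra (contractLeft)
open ExteriorAlgebra (ι)
open Module
open Literature.AlgebraicGeometry.Motives Literature.AlgebraicGeometry.HodgeTheory

namespace Summit.Ventures.HSemireg

namespace ContractionSpan

/-! ### 1. Telescoping -/

section Ring
variable {K : Type*} [CommRing K] {M N : Type*} [AddCommGroup M] [Module K M] [AddCommGroup N] [Module K N]

/-- `ι_d (z ∧ w) = (ι_d z) ∧ w` when `d(w) = 0` (left induction on `z`). [cite: BourbakiAlgebre1a3, Ch. III §11 no. 9] -/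
theorem contractLeft_mul_ι_of_apply_eq_zero {d : Module.Dual K N} {w : N} (hw : d w = 0) (z : ExteriorAlgebra K N) :
    contractLeft d (z * ι K w) = contractLeft d z * ι K w := by
  induction z using left_induction' with
  | h0 r =>
    rw [CliffordAlgebra.contractLeft_algebraMap, zero_mul, ← Algebra.smul_def, map_smul, CliffordAlgebra.contractLeft_ι,
      hw, map_zero, smul_zero]
  | hadd x y hx hy => rw [add_mul, map_add, hx, hy, map_add, add_mul]
  | hmul x m hx =>
    rw [mul_assoc, CliffordAlgebra.contractLeft_ι_mul, hx, CliffordAlgebra.contractLeft_ι_mul, sub_mul, smul_mul_assoc,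
      mul_assoc]

/-- A product of `pairAct` generators all pairing to `0` with `w` passes a right factor `w`:
`pairAct φ (m₁ ∧ ⋯ ∧ m_k) (z ∧ w) = (pairAct φ (m₁ ∧ ⋯ ∧ m_k) z) ∧ w`. [cite: BourbakiAlgebre1a3, Ch. III §11 no. 9] -/
theorem pairAct_prod_mul_ι (φ : M →ₗ[K] Module.Dual K N) {w : N} (l : List M) (hl : ∀ m ∈ l, φ m w = 0)
    (z : ExteriorAlgebra K N) :
    pairAct K φ (l.map (ι K)).prod (z * ι K w) = pairAct K φ (l.map (ι K)).prod z * ι K w := by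
  induction l generalizing z with
  | nil => simp only [List.map_nil, List.prod_nil, map_one, Module.End.one_apply]
  | cons m l ih =>
    rw [List.map_cons, List.prod_cons, map_mul (pairAct K φ), Module.End.mul_apply, Module.End.mul_apply, pairAct_ι,
      ih (fun m' hm' => hl m' (List.mem_cons_of_mem m hm')),
      contractLeft_mul_ι_of_apply_eq_zero (hl m List.mem_cons_self)]

/-- **TELESCOPING**: for a list of pairs `(mᵢ, nᵢ)` with `φ mᵢ nᵢ = 1` and `φ m_j nᵢ = 0` whenever `i` comes before
`j`, `(m₁ ∧ ⋯ ∧ m_k) ⌟ (n_k ∧ ⋯ ∧ n₁) = 1`: the innermost contraction `ι_{φ m_k}` removes the outermost factor `n_k`,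
and so on — no signs. [cite: BourbakiAlgebre1a3, Ch. III §11 no. 11 Prop. 12] -/
theorem pairAct_prod_prod_reverse (φ : M →ₗ[K] Module.Dual K N) (l : List (M × N))
    (hdiag : ∀ p ∈ l, φ p.1 p.2 = 1) (hoff : l.Pairwise fun p q => φ q.1 p.2 = 0) :
    pairAct K φ (l.map fun p => ι K p.1).prod (l.map fun p => ι K p.2).reverse.prod = 1 := by
  induction l with
  | nil => simp only [List.map_nil, List.prod_nil, List.reverse_nil, map_one, Module.End.one_apply]
  | cons p l ih =>
    rw [List.pairwise_cons] at hoff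
    have h1 : (List.map (fun p : M × N => ι K p.1) l) = (l.map Prod.fst).map (ι K) := by rw [List.map_map]; rfl
    rw [List.map_cons, List.map_cons, List.prod_cons, List.reverse_cons, List.prod_append, List.prod_singleton,
      map_mul (pairAct K φ), Module.End.mul_apply, pairAct_ι, h1,
      pairAct_prod_mul_ι φ (l.map Prod.fst) (fun m hm => by
        obtain ⟨q, hq, rfl⟩ := List.mem_map.mp hm
        exact hoff.1 q hq) _,
      ← h1, ih (fun q hq => hdiag q (List.mem_cons_of_mem p hq)) hoff.2, one_mul, CliffordAlgebra.contractLeft_ι,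
      hdiag p List.mem_cons_self, map_one]

/-- A list product of generators lies in the graded piece of its length. [cite: BourbakiAlgebre1a3, Ch. III §7 no. 1] -/
theorem list_prod_map_ι_mem (l : List N) : (l.map (ι K)).prod ∈ ⋀[K]^l.length N := by
  induction l with
  | nil => rw [List.map_nil, List.prod_nil, List.length_nil, ExteriorAlgebra.exteriorPower, pow_zero]; exact Submodule.one_le.mp le_rfl
  | cons m l ih =>
    rw [List.map_cons, List.prod_cons, List.length_cons, ExteriorAlgebra.exteriorPower, pow_succ']
    exact Submodule.mul_mem_mul (LinearMap.mem_range_self _ m) ih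

/-- **`D ∘ E`-type composites are scalars (the `V`-side version of `pairDual_eval_comp_id`)**: with
`D = pairDual id ω`, `E = pairDual eval ω'`, `ω` a top form and `D ω' = c'·1`, `D (E x) = c'·x` for every `x ∈ Λ V`.
[cite: BourbakiAlgebre1a3, Ch. III §11 no. 11 Prop. 12] -/
theorem pairDual_id_comp_eval {V : Type*} [AddCommGroup V] [Module K V] {ω : ExteriorAlgebra K V}
    {ω' : ExteriorAlgebra K (Module.Dual K V)} (hω : ∀ v : V, ι K v * ω = 0) {c' : K}
    (hc' : pairDual K (LinearMap.id : Module.Dual K V →ₗ[K] Module.Dual K V) ω ω' = algebraMap K _ c')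
    (x : ExteriorAlgebra K V) :
    pairDual K (LinearMap.id : Module.Dual K V →ₗ[K] Module.Dual K V) ω (pairDual K (Module.Dual.eval K V) ω' x) =
      c' • x := by
  induction x using left_induction' with
  | h0 r => rw [pairDual_algebraMap, map_smul, hc', Algebra.algebraMap_eq_smul_one, Algebra.algebraMap_eq_smul_one,
      smul_comm]
  | hadd x y hx hy => rw [map_add, map_add, hx, hy, smul_add]
  | hmul x v hx =>
    rw [pairDual_ι_mul, ← flip_id_eq_eval, pairDual_contractLeft_flip _ hω, flip_id_eq_eval, hx, mul_smul_comm]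

end Ring

/-! ### 2. The volume pair of a basis and its dual basis -/

section Basis
variable {K : Type*} [Field K] {V : Type*} [AddCommGroup V] [Module K V] {n : ℕ} (b : Module.Basis (Fin n) K V)

/-- `ω_b = b₀ ∧ ⋯ ∧ b_{n-1}` is a top form: `v ∧ ω_b = 0`. [cite: BourbakiAlgebre1a3, Ch. III §7 no. 3 Prop. 6] -/
theorem ι_mul_prod_basis_eq_zero (v : V) : ι K v * ((List.ofFn b).map (ι K)).prod = 0 := by
  haveI : FiniteDimensional K V := Module.Finite.of_basis b
  have hmem := list_prod_map_ι_mem (K := K) (List.ofFn b)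
  rw [List.length_ofFn] at hmem
  exact ι_mul_eq_zero_of_mem_top (by rw [Module.finrank_eq_card_basis b, Fintype.card_fin]) hmem v

/-- `ω'_b = b^*_{n-1} ∧ ⋯ ∧ b^*_0` is a top form of `V^*`. [cite: BourbakiAlgebre1a3, Ch. III §7 no. 3 Prop. 6] -/
theorem ι_mul_prod_coord_reverse_eq_zero (θ : Module.Dual K V) :
    ι K θ * ((List.ofFn b.coord).map (ι K)).reverse.prod = 0 := by
  haveI : FiniteDimensional K (Module.Dual K V) := Module.Finite.of_basis b.dualBasis
  have hmem := list_prod_map_ι_mem (K := K) (List.ofFn b.coord).reverse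
  rw [List.map_reverse] at hmem
  rw [List.length_reverse, List.length_ofFn] at hmem
  refine ι_mul_eq_zero_of_mem_top ?_ hmem θ
  rw [Module.finrank_eq_card_basis b.dualBasis, Fintype.card_fin]

/-- **`E ω_b = 1`**: `(b₀ ∧ ⋯ ∧ b_{n-1}) ⌟ (b^*_{n-1} ∧ ⋯ ∧ b^*_0) = 1` along `eval` (telescoping with `b^*_i(b_j) = δ_ij`).
[cite: BourbakiAlgebre1a3, Ch. III §11 no. 11 Prop. 12] -/
theorem pairDual_eval_prod_basis :
    pairDual K (Module.Dual.eval K V) ((List.ofFn b.coord).map (ι K)).reverse.prod ((List.ofFn b).map (ι K)).prod = 1 := by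
  have h := pairAct_prod_prod_reverse (K := K) (Module.Dual.eval K V) (List.ofFn fun i => (b i, b.coord i))
    (fun p hp => by
      obtain ⟨i, rfl⟩ := List.mem_ofFn.mp hp
      rw [Module.Dual.eval_apply, Module.Basis.coord_apply, Module.Basis.repr_self, Finsupp.single_eq_same])
    (List.pairwise_ofFn.mpr fun i j hij => by
      rw [Module.Dual.eval_apply, Module.Basis.coord_apply, Module.Basis.repr_self, Finsupp.single_eq_of_ne (ne_of_lt hij)])
  rw [List.map_ofFn, List.map_ofFn] at h
  rw [pairDual_apply, List.map_ofFn, List.map_ofFn]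
  exact h

/-- **`D ω'_b = 1`**: `(b^*_{n-1} ∧ ⋯ ∧ b^*_0) ⌟ (b₀ ∧ ⋯ ∧ b_{n-1}) = 1` along `id` (the same telescope read backwards).
[cite: BourbakiAlgebre1a3, Ch. III §11 no. 11 Prop. 12] -/
theorem pairDual_id_prod_coord :
    pairDual K (LinearMap.id : Module.Dual K V →ₗ[K] Module.Dual K V) ((List.ofFn b).map (ι K)).prod
      ((List.ofFn b.coord).map (ι K)).reverse.prod = 1 := by
  have h := pairAct_prod_prod_reverse (K := K) (LinearMap.id : Module.Dual K V →ₗ[K] Module.Dual K V)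
    ((List.ofFn fun i => (b i, b.coord i)).map Prod.swap).reverse
    (fun p hp => by
      obtain ⟨q, hq, rfl⟩ := List.mem_map.mp (List.mem_reverse.mp hp)
      obtain ⟨i, rfl⟩ := List.mem_ofFn.mp hq
      rw [Prod.fst_swap, Prod.snd_swap, LinearMap.id_apply, Module.Basis.coord_apply, Module.Basis.repr_self,
        Finsupp.single_eq_same])
    (by
      rw [List.pairwise_reverse, List.pairwise_map]
      exact List.pairwise_ofFn.mpr fun i j hij => by
        rw [Prod.fst_swap, Prod.snd_swap, LinearMap.id_apply, Module.Basis.coord_apply, Module.Basis.repr_self,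
          Finsupp.single_eq_of_ne (ne_of_lt hij)])
  rw [List.map_reverse, List.map_map, List.map_reverse, List.reverse_reverse, List.map_map] at h
  rw [pairDual_apply, List.map_ofFn, List.map_ofFn]
  rw [List.map_ofFn, List.map_ofFn] at h
  exact h

/-- **THE RANK THEOREM, unconditional form (class-level FM-invariance of the contraction rank).** For a
finite-dimensional `V` over a field with a basis `b`, `E = pairDual eval ω'_b : Λ V → Λ(V^*)` (the Fourier duality map of
the volume pair of `b`), vectors `L ⊆ V` and forms `Θ ⊆ V^*` killing `L`: for EVERY class `x ∈ Λ V`,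
`rank span_V L Θ x = rank span_{V^*} Θ (eval L) (E x)` — the polyvector contraction rank of `x` on `V` (vectors `L` by
wedge, forms `Θ` by interior product) equals that of its Fourier dual `E x` on `V^*` (now `Θ` by wedge, `L` by interior
product): «`r(X, ch E) = r(X̂, ch Φ(E))`» once `ch Φ(E) = F(ch E)` is supplied BY NAME.
[cite: BourbakiAlgebre1a3, Ch. III §11 no. 11 Prop. 12] [cite: Mukai1981, Thm. 2.2] [cite: BuchweitzFlenner2008HH, Prop. 6.4.4] -/
theorem rank_span_fourier_eq {L : Set V} {Θ : Set (Module.Dual K V)} (hΘL : ∀ θ ∈ Θ, ∀ q ∈ L, θ q = 0)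
    (x : ExteriorAlgebra K V) :
    Module.rank K (span L Θ x) =
      Module.rank K (span Θ (Module.Dual.eval K V '' L)
        (pairDual K (Module.Dual.eval K V) ((List.ofFn b.coord).map (ι K)).reverse.prod x)) := by
  set ω : ExteriorAlgebra K V := ((List.ofFn b).map (ι K)).prod with hωdef
  set ω' : ExteriorAlgebra K (Module.Dual K V) := ((List.ofFn b.coord).map (ι K)).reverse.prod with hω'def
  have hω : ∀ v : V, ι K v * ω = 0 := ι_mul_prod_basis_eq_zero b
  have hω' : ∀ θ : Module.Dual K V, ι K θ * ω' = 0 := ι_mul_prod_coord_reverse_eq_zero b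
  have hc : pairDual K (Module.Dual.eval K V) ω' ω = algebraMap K _ 1 := by rw [map_one]; exact pairDual_eval_prod_basis b
  have hc' : pairDual K (LinearMap.id : Module.Dual K V →ₗ[K] Module.Dual K V) ω ω' = algebraMap K _ 1 := by
    rw [map_one]; exact pairDual_id_prod_coord b
  -- `x = D (E x)` (composite `= 1 • x`), then the conditional rank theorem at `ξ = E x`
  have hx : pairDual K (LinearMap.id : Module.Dual K V →ₗ[K] Module.Dual K V) ω
      (pairDual K (Module.Dual.eval K V) ω' x) = x := by
    rw [pairDual_id_comp_eval hω hc', one_smul]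
  conv_lhs => rw [← hx]
  exact rank_span_pairDual_eq hω hω' hc isUnit_one hΘL _

end Basis

/-! ### 3. Iso-transport: the contraction span is covariant under linear isomorphisms of `V` (red-5 N-1) -/

section Transport
universe u v
variable {K : Type u} [Field K] {V W : Type v} [AddCommGroup V] [Module K V] [AddCommGroup W] [Module K W]

/-- **ISO-TRANSPORT of the contraction span**: for a linear isomorphism `g : V ≅ W`,
`Λg (span_V L Θ x) = span_W (g L) (Θ ∘ g⁻¹) (Λg x)`. [cite: BourbakiAlgebre1a3, Ch. III §7 no. 1 and §11 no. 9] -/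
theorem map_span_equiv (g : V ≃ₗ[K] W) (L : Set V) (Θ : Set (Module.Dual K V)) (x : ExteriorAlgebra K V) :
    (span L Θ x).map (ExteriorAlgebra.map g.toLinearMap).toLinearMap =
      span (g '' L) ((fun θ : Module.Dual K V => θ ∘ₗ g.symm.toLinearMap) '' Θ) (ExteriorAlgebra.map g.toLinearMap x) := by
  have hθ : ∀ θ : Module.Dual K V, ∀ y : ExteriorAlgebra K V,
      contractLeft (θ ∘ₗ g.symm.toLinearMap) (ExteriorAlgebra.map g.toLinearMap y) =
        ExteriorAlgebra.map g.toLinearMap (contractLeft θ y) := fun θ y => by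
    rw [contractLeft_map, LinearMap.comp_assoc, LinearEquiv.symm_comp, LinearMap.comp_id]
  apply le_antisymm
  · rw [Submodule.map_le_iff_le_comap]
    refine Submodule.span_le.mpr ?_
    rintro y ((⟨q₁, hq₁, q₂, hq₂, rfl⟩ | ⟨q, hq, θ, hθ', rfl⟩) | ⟨θ₁, h₁, θ₂, h₂, rfl⟩)
    · rw [SetLike.mem_coe, Submodule.mem_comap, AlgHom.toLinearMap_apply, map_mul, map_mul, ExteriorAlgebra.map_apply_ι,
        ExteriorAlgebra.map_apply_ι]
      exact Submodule.subset_span (Or.inl (Or.inl ⟨g q₁, ⟨q₁, hq₁, rfl⟩, g q₂, ⟨q₂, hq₂, rfl⟩, rfl⟩))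
    · rw [SetLike.mem_coe, Submodule.mem_comap, AlgHom.toLinearMap_apply, map_mul, ExteriorAlgebra.map_apply_ι, ← hθ]
      exact Submodule.subset_span (Or.inl (Or.inr ⟨g q, ⟨q, hq, rfl⟩, _, ⟨θ, hθ', rfl⟩, rfl⟩))
    · rw [SetLike.mem_coe, Submodule.mem_comap, AlgHom.toLinearMap_apply, ← hθ, ← hθ]
      exact Submodule.subset_span (Or.inr ⟨_, ⟨θ₁, h₁, rfl⟩, _, ⟨θ₂, h₂, rfl⟩, rfl⟩)
  · refine Submodule.span_le.mpr ?_
    rintro y ((⟨_, ⟨q₁, hq₁, rfl⟩, _, ⟨q₂, hq₂, rfl⟩, rfl⟩ | ⟨_, ⟨q, hq, rfl⟩, _, ⟨θ, hθ', rfl⟩, rfl⟩) |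
      ⟨_, ⟨θ₁, h₁, rfl⟩, _, ⟨θ₂, h₂, rfl⟩, rfl⟩)
    · exact ⟨ι K q₁ * (ι K q₂ * x), Submodule.subset_span (Or.inl (Or.inl ⟨q₁, hq₁, q₂, hq₂, rfl⟩)), by
        rw [AlgHom.toLinearMap_apply, map_mul, map_mul, ExteriorAlgebra.map_apply_ι, ExteriorAlgebra.map_apply_ι]; rfl⟩
    · exact ⟨ι K q * contractLeft θ x, Submodule.subset_span (Or.inl (Or.inr ⟨q, hq, θ, hθ', rfl⟩)), by
        rw [AlgHom.toLinearMap_apply, map_mul, ExteriorAlgebra.map_apply_ι, ← hθ]; rfl⟩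
    · exact ⟨contractLeft θ₁ (contractLeft θ₂ x), Submodule.subset_span (Or.inr ⟨θ₁, h₁, θ₂, h₂, rfl⟩), by
        rw [AlgHom.toLinearMap_apply, ← hθ, ← hθ]⟩

/-- `Λg` is injective for a linear isomorphism `g` (`Λg⁻¹ ∘ Λg = Λ id = id`). [cite: BourbakiAlgebre1a3, Ch. III §7 no. 1] -/
theorem map_equiv_injective (g : V ≃ₗ[K] W) : Function.Injective (ExteriorAlgebra.map g.toLinearMap) := by
  refine Function.LeftInverse.injective (g := ExteriorAlgebra.map g.symm.toLinearMap) fun x => ?_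
  induction x using ExteriorAlgebra.induction with
  | algebraMap r => rw [AlgHom.commutes, AlgHom.commutes]
  | ι v => simp only [ExteriorAlgebra.map_apply_ι, LinearEquiv.coe_coe, LinearEquiv.symm_apply_apply]
  | mul a b ha hb => rw [map_mul, map_mul, ha, hb]
  | add a b ha hb => rw [map_add, map_add, ha, hb]

/-- **The contraction rank is invariant under linear isomorphisms** carrying `(L, Θ, x)` to
`(g L, Θ ∘ g⁻¹, Λg x)` (red-5 N-1's iso-transport; e.g. the sign automorphism `Λ(i·id)` relating the Fourier duality
`E` to the printed cohomological transform on even classes). [cite: BourbakiAlgebre1a3, Ch. III §7 no. 1] -/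
theorem rank_span_map_equiv (g : V ≃ₗ[K] W) (L : Set V) (Θ : Set (Module.Dual K V)) (x : ExteriorAlgebra K V) :
    Module.rank K (span (g '' L) ((fun θ : Module.Dual K V => θ ∘ₗ g.symm.toLinearMap) '' Θ)
      (ExteriorAlgebra.map g.toLinearMap x)) = Module.rank K (span L Θ x) := by
  rw [← map_span_equiv]
  exact rank_map_eq (map_equiv_injective g) _

end Transport

end ContractionSpan

/-! ### 4. The real carriers: `contractionRank A κ` equals the dual-side rank of the Fourier dual class -/

/-- **FM-invariance in the `contractionRank` currency (class level).** For an abelian variety `A/ℂ` and any class family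
`κ`, with `V = H¹(A(ℂ); ℂ)`, `b` ANY basis of `V` (Mathlib's `finBasis`), `E = pairDual eval ω'_b : Λ V → Λ(V^*)` the Fourier
duality map: `contractionRank A κ` = the rank of the contraction span of `E(Σ_p κ_p)` on the DUAL side — vectors
`vectorFieldSet A = H⁰(A, T_A) ⊆ V^*` acting by wedge, forms `eval(hodgeZeroOneSet A) = H^{0,1}(A) ⊆ V^{**}` acting by
interior product. Reading the dual side as `(H¹(Â), H^{0,1}(Â), H⁰(Â, T))` and `E(ch F)` as `± ch(Φ F)` is the printed
dictionary ([Mukai1981] Thm. 2.2; [Lange2023AbelianVarietiesComplex] §6.2.4), BY NAME. [cite: Mukai1981, Thm. 2.2] [cite: BuchweitzFlenner2008HH, Prop. 6.4.4]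
[cite: BourbakiAlgebre1a3, Ch. III §11 no. 11 Prop. 12] -/
theorem contractionRank_eq_rank_span_fourierDual (A : AbelianVariety ℂ) (κ : ∀ p : ℕ, complexBetti A.X (2 * p)) :
    haveI : Module.Finite ℂ (complexBetti A.X 1) := abelianVarietyCohomologyExteriorH1_holds.finite_one A
    contractionRank A κ =
      Module.rank ℂ (ContractionSpan.span (vectorFieldSet A) (Module.Dual.eval ℂ (complexBetti A.X 1) '' hodgeZeroOneSet A)
        (ContractionSpan.pairDual ℂ (Module.Dual.eval ℂ (complexBetti A.X 1))
          ((List.ofFn (Module.finBasis ℂ (complexBetti A.X 1)).coord).map (ι ℂ)).reverse.prod (totalExteriorClass A κ))) := by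
  haveI : Module.Finite ℂ (complexBetti A.X 1) := abelianVarietyCohomologyExteriorH1_holds.finite_one A
  rw [contractionRank_eq_rank_span]
  exact ContractionSpan.rank_span_fourier_eq (L := hodgeZeroOneSet A) (Θ := vectorFieldSet A)
    (Module.finBasis ℂ (complexBetti A.X 1)) (fun _ hθ => hθ) _

/-! ### 5. Transport binder for the census: `r(A', κ') = r(A, κ)` along «dual side of `A` ≅ `H¹(A')`» plus a twist -/

/-- **The class-level FM + twist move in the `contractionRank` currency** (the glue th-7 §N.5 / the g = 4 sentence use
ON PAPER: «`r(E₀ ⊗ M_B) = r(I_Z)`»). Data BY VALUE: a linear isomorphism `g : H¹(A)^* ≅ H¹(A')` (on paper: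
`H¹(Â) = H¹(A)^*` composed with `Â ≅ A'`) carrying the vector fields of `A` onto `H^{0,1}(A')` and the evaluations of
`H^{0,1}(A)` onto the vector fields of `A'`, a twist class `c` of `A'` (`c₁(M)`, type `(1,1)`, `c^N = 0`), and the class
identity `Σ κ'_p = Λg(E(Σ κ_p)) · e^{c}` (cohomological transform + `ch(E ⊗ M) = ch(E) e^{c₁(M)}`, BY NAME). Then
`contractionRank A' κ' = contractionRank A κ` — by `contractionRank_eq_rank_span_fourierDual`, the iso-transport
`rank_span_map_equiv` and seat p6's twist lemma `rank_span_mul_expSum_eq`. [cite: Mukai1981, Thm. 2.2]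
[cite: BuchweitzFlenner2008HH, Prop. 6.4.4] [cite: BourbakiAlgebre1a3, Ch. III §11 no. 11 Prop. 12] -/
theorem contractionRank_eq_of_fourier_transport (A A' : AbelianVariety ℂ) (κ : ∀ p : ℕ, complexBetti A.X (2 * p))
    (κ' : ∀ p : ℕ, complexBetti A'.X (2 * p))
    (g : Module.Dual ℂ (complexBetti A.X 1) ≃ₗ[ℂ] complexBetti A'.X 1)
    (hL : ⇑g '' vectorFieldSet A = hodgeZeroOneSet A')
    (hΘ : (fun θ : Module.Dual ℂ (Module.Dual ℂ (complexBetti A.X 1)) => θ ∘ₗ g.symm.toLinearMap) ''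
      (Module.Dual.eval ℂ (complexBetti A.X 1) '' hodgeZeroOneSet A) = vectorFieldSet A')
    {c : ExteriorAlgebra ℂ (complexBetti A'.X 1)}
    (hc : c ∈ Submodule.span ℂ {z : ExteriorAlgebra ℂ (complexBetti A'.X 1) |
      ∃ v : complexBetti A'.X 1, ∃ q ∈ hodgeZeroOneSet A', z = ι ℂ v * ι ℂ q}) {N : ℕ} (hN : c ^ N = 0)
    (hx : haveI : Module.Finite ℂ (complexBetti A.X 1) := abelianVarietyCohomologyExteriorH1_holds.finite_one A
      totalExteriorClass A' κ' = ExteriorAlgebra.map g.toLinearMap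
        (ContractionSpan.pairDual ℂ (Module.Dual.eval ℂ (complexBetti A.X 1))
          ((List.ofFn (Module.finBasis ℂ (complexBetti A.X 1)).coord).map (ι ℂ)).reverse.prod (totalExteriorClass A κ)) *
        ∑ k ∈ Finset.range N, ((k.factorial : ℂ)⁻¹) • c ^ k) :
    contractionRank A' κ' = contractionRank A κ := by
  haveI : Module.Finite ℂ (complexBetti A.X 1) := abelianVarietyCohomologyExteriorH1_holds.finite_one A
  rw [contractionRank_eq_rank_span A' κ', hx,
    ContractionSpan.rank_span_mul_expSum_eq (L := hodgeZeroOneSet A') (Θ := vectorFieldSet A') (fun _ hθ => hθ) hc hN,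
    ← hL, ← hΘ, ContractionSpan.rank_span_map_equiv, contractionRank_eq_rank_span_fourierDual]

end Summit.Ventures.HSemireg

end
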